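import Summits.RiemannHypothesis.RiemannHypothesis.Theses.SignCone
import Literature.NumberTheory.LFunctions.WeilExplicit
import Literature.NumberTheory.LFunctions.WeilExplicitFormulaProofs
import Literature.NumberTheory.LFunctions.WeilCombZeroSide
import Literature.NumberTheory.LFunctions.WeilCombNormLowerBound
import Literature.NumberTheory.LFunctions.WeilSmallSupportPositivity
import HarnessLib

/-!
# Stub `stub_combZeroSide` of line `Sketch` for crux `SignCone.ConeMagnification`
(item stmt-RiemannHypothesis-16303, route route-RiemannHypothesis-SignCone)

**`ζ`-MOLLIFIED RESONATOR COMBS ARE WEIL-NEUTRAL.**  For a finitely supported real resonator `α`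
(support `≤ L`), a Weil test `b₁` supported in `[-1, 1]`, `0 < θ < 1`, `κ = (log M)^θ` and the comb
`g(u) = ∑_{m ≤ LM} a_m b₁((u - log m) M/κ)`, `a_m = ∑_{k ∣ m, k ≤ M} α(m/k)/√k`, the full Weil
functional of `K = g ⋆ g̃` is `o(‖g‖₂²)`:
`|Re (W_polar(K) + W_arch(K) - P_Λ(K))| ≤ ε ‖g‖₂²` for all `M ≥ M₀(α, L, b₁, θ, ε)`.

Proof.  By the explicit formula (`explicit_formula_holds`) `W(K)` is the limit of the truncated
zero sides `∑_{|Im ρ| ≤ T} m(ρ) K̂(ρ)`, and every one of these is bounded by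
`C C_α² (κ/M)² (‖b₁‖'² M + ‖b₁^{(n)}‖'² κ^{-2n} (1 + log M)³ M)`
(`Literature.NumberTheory.LFunctions.exists_norm_weilZeroSidePartial_comb_le`: `K̂(ρ) = ĝ(ρ) conj ĝ(1-ρ̄)`
carries `ζ_M(1-ρ) ζ_M(ρ̄)`, which is small at EVERY zero below height `M` by the uniform
truncation (4.11.1) and small on average above height `M` by the complementary-sum representation,
two-sided mean values uniform across the strip, Sobolev on unit squares and the local zero count;
the bump transform supplies `(κ/M)²` and the decay `κ^{-2n}` above height `M/κ`).  On the other
side `‖g‖₂² ≥ (κ/M) ‖b₁‖₂² (c log(M/κ) - C)`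
(`Literature.NumberTheory.LFunctions.exists_integral_norm_sq_comb_ge`: the teeth `m ≤ M/(4κ)` are
disjoint and the mollified coefficients have mean square `≫ log`).  With `κ = (log M)^θ`,
`0 < θ < 1` and `θ(2n-1) > 2` the ratio is `O((log M)^{θ-1} + (log M)^{2-θ(2n-1)}) → 0`.
The degenerate cases (`α ≡ 0` on `[1, L]` or `b₁ ≡ 0`) give `g ≡ 0` and `0 ≤ 0`.
-/

noncomputable section

-- `Summit.RiemannHypothesis.RiemannHypothesis.…` repeats a namespace component by design (D-0017 layout).
set_option linter.dupNamespace false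

open scoped BigOperators ComplexConjugate Topology
open Complex MeasureTheory Set Filter

namespace Summit.RiemannHypothesis.RiemannHypothesis.Theorems.SignConeConeMagnification

open Literature.NumberTheory.LFunctions

/-! ## The Weil functional and its truncated zero sides -/

/-- `W_polar(K) + W_arch(K) - P_Λ(K) = W(K)` (the Weil functional of `WeilExplicit`). [folklore] -/
theorem polar_add_arch_sub_prime_eq (K : ℝ → ℂ) :
    weilPolarTerm K + weilArchTerm K -
        ∑' n : ℕ, ((ArithmeticFunction.vonMangoldt n : ℝ) : ℂ) / (Real.sqrt n : ℂ) *
          (K (Real.log n) + K (-Real.log n)) = weilFunctional K := by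
  unfold weilFunctional weilPrimeTerm
  ring

/-- By the explicit formula, a bound valid for every truncated zero side of a Weil test `K` bounds
`‖W(K)‖`. [folklore] -/
theorem norm_weilFunctional_le_of_partial_le {K : ℝ → ℂ} (hK : IsWeilTest K) {B : ℝ}
    (h : ∀ T : ℝ, ‖weilZeroSidePartial K T‖ ≤ B) : ‖weilFunctional K‖ ≤ B := by
  have hZ : HasWeilZeroSide K (weilFunctional K) := explicit_formula_holds hK
  exact le_of_tendsto' hZ.norm fun T ↦ h T

/-! ## Elementary growth lemmas -/

/-- `8 log x ≤ x` for `x ≥ 256`. [folklore] -/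
theorem eight_mul_log_le {x : ℝ} (hx : 256 ≤ x) : 8 * Real.log x ≤ x := by
  have hx0 : 0 < x := by linarith
  have hs : Real.log x = 2 * Real.log (Real.sqrt x) := by rw [Real.log_sqrt hx0.le]; ring
  have hs1 : Real.log (Real.sqrt x) ≤ Real.sqrt x - 1 := Real.log_le_sub_one_of_pos (Real.sqrt_pos.2 hx0)
  have h16 : 16 ≤ Real.sqrt x := by
    rw [show (16 : ℝ) = Real.sqrt 256 by rw [show (256 : ℝ) = 16 ^ 2 by norm_num, Real.sqrt_sq (by norm_num)]]
    exact Real.sqrt_le_sqrt hx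
  have hsq : Real.sqrt x * Real.sqrt x = x := Real.mul_self_sqrt hx0.le
  nlinarith

/-- The real-variable budget: for `0 < θ < 1`, `θ(2n-1) > 2`, `A₁, A₂ ≥ 0`, `E > 0` and any `C`,
eventually in `x`: `A₁ x^θ + A₂ (x^θ/(x^θ)^{2n}) (1+x)³ ≤ E x/4 - C`... precisely `≤ E (x/2) - C`.
[folklore] -/
theorem eventually_budget {θ : ℝ} (hθ0 : 0 < θ) (hθ1 : θ < 1) {n : ℕ}
    (hn : 2 < θ * (2 * n - 1)) {A₁ A₂ E : ℝ} (hA₁ : 0 ≤ A₁) (hA₂ : 0 ≤ A₂) (hE : 0 < E) (C : ℝ) :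
    ∀ᶠ x : ℝ in atTop,
      A₁ * x ^ θ + A₂ * (x ^ θ / (x ^ θ) ^ (2 * n)) * (1 + x) ^ 3 ≤ E * (x / 2) - C := by
  set δ₁ : ℝ := E / (8 * (A₁ + 1)) with hδ₁
  set δ₂ : ℝ := E / (64 * (A₂ + 1)) with hδ₂
  have hδ₁pos : 0 < δ₁ := by positivity
  have hδ₂pos : 0 < δ₂ := by positivity
  set e : ℝ := θ - 2 * n * θ + 2 with he
  have hepos : 0 < -e := by rw [he]; nlinarith
  have T1 : Tendsto (fun x : ℝ ↦ x ^ (θ - 1)) atTop (𝓝 0) := by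
    have := tendsto_rpow_neg_atTop (y := 1 - θ) (by linarith)
    simpa [neg_sub] using this
  have T2 : Tendsto (fun x : ℝ ↦ x ^ e) atTop (𝓝 0) := by
    have := tendsto_rpow_neg_atTop (y := -e) hepos
    simpa using this
  filter_upwards [eventually_ge_atTop (1 : ℝ), eventually_ge_atTop (4 * C / E),
    T1.eventually (ge_mem_nhds hδ₁pos), T2.eventually (ge_mem_nhds hδ₂pos)] with x hx1 hxC h1 h2
  have hx0 : 0 < x := by linarith
  -- `x^θ = x^{θ-1} x ≤ δ₁ x`
  have hpow1 : x ^ θ ≤ δ₁ * x := by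
    have : x ^ θ = x ^ (θ - 1) * x := by rw [Real.rpow_sub_one hx0.ne', div_mul_cancel₀ _ hx0.ne']
    rw [this]; exact mul_le_mul_of_nonneg_right h1 hx0.le
  -- `x^θ/(x^θ)^{2n} (1+x)³ ≤ 8 x^e x ≤ 8 δ₂ x`
  have hpow2 : x ^ θ / (x ^ θ) ^ (2 * n) * (1 + x) ^ 3 ≤ 8 * δ₂ * x := by
    have hq : x ^ θ / (x ^ θ) ^ (2 * n) = x ^ (θ - 2 * n * θ) := by
      rw [← Real.rpow_natCast, ← Real.rpow_mul hx0.le, Real.rpow_sub hx0]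
      congr 1; push_cast; ring
    have hcube : (1 + x) ^ 3 ≤ 8 * x ^ 3 := by
      have h := pow_le_pow_left₀ (by linarith : (0 : ℝ) ≤ 1 + x) (by linarith : 1 + x ≤ 2 * x) 3
      calc (1 + x) ^ 3 ≤ (2 * x) ^ 3 := h
        _ = 8 * x ^ 3 := by ring
    have hxe : x ^ (θ - 2 * n * θ) * x ^ 3 = x ^ e * x := by
      rw [he, show θ - 2 * ↑n * θ + 2 = (θ - 2 * n * θ + 3) - 1 by ring, Real.rpow_sub_one hx0.ne',
        div_mul_cancel₀ _ hx0.ne', ← Real.rpow_natCast, ← Real.rpow_add hx0]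
      push_cast; ring_nf
    have hxepos : 0 ≤ x ^ (θ - 2 * n * θ) := by positivity
    rw [hq]
    calc x ^ (θ - 2 * n * θ) * (1 + x) ^ 3 ≤ x ^ (θ - 2 * n * θ) * (8 * x ^ 3) :=
          mul_le_mul_of_nonneg_left hcube hxepos
      _ = 8 * (x ^ e * x) := by rw [← hxe]; ring
      _ ≤ 8 * (δ₂ * x) := by
          refine mul_le_mul_of_nonneg_left (mul_le_mul_of_nonneg_right h2 hx0.le) (by norm_num)
      _ = 8 * δ₂ * x := by ring
  -- the coefficients
  have hc1 : A₁ * δ₁ ≤ E / 8 := by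
    have e1 : A₁ * δ₁ = A₁ / (A₁ + 1) * (E / 8) := by rw [hδ₁]; field_simp
    rw [e1]
    have : A₁ / (A₁ + 1) ≤ 1 := div_le_one_of_le₀ (by linarith) (by positivity)
    nlinarith
  have hc2 : A₂ * (8 * δ₂) ≤ E / 8 := by
    have e1 : A₂ * (8 * δ₂) = A₂ / (A₂ + 1) * (E / 8) := by rw [hδ₂]; field_simp; ring
    rw [e1]
    have : A₂ / (A₂ + 1) ≤ 1 := div_le_one_of_le₀ (by linarith) (by positivity)
    nlinarith
  have hEx : 4 * C ≤ E * x := by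
    have := (div_le_iff₀ hE).1 hxC; linarith
  calc A₁ * x ^ θ + A₂ * (x ^ θ / (x ^ θ) ^ (2 * n)) * (1 + x) ^ 3
      ≤ A₁ * (δ₁ * x) + A₂ * (8 * δ₂ * x) := by
        have e2 : A₂ * (x ^ θ / (x ^ θ) ^ (2 * n)) * (1 + x) ^ 3
            = A₂ * (x ^ θ / (x ^ θ) ^ (2 * n) * (1 + x) ^ 3) := by ring
        rw [e2]
        exact add_le_add (mul_le_mul_of_nonneg_left hpow1 hA₁) (mul_le_mul_of_nonneg_left hpow2 hA₂)
    _ = (A₁ * δ₁) * x + (A₂ * (8 * δ₂)) * x := by ring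
    _ ≤ E / 8 * x + E / 8 * x :=
        add_le_add (mul_le_mul_of_nonneg_right hc1 hx0.le) (mul_le_mul_of_nonneg_right hc2 hx0.le)
    _ ≤ E * (x / 2) - C := by linarith

/-- The budget along `M → ∞` with `κ = (log M)^θ`: eventually `1 ≤ log M`, `8κ ≤ M` and
`A₁ κ + A₂ (κ/κ^{2n}) (1 + log M)³ ≤ E log(M/κ) - C`. [folklore] -/
theorem eventually_budget_nat {θ : ℝ} (hθ0 : 0 < θ) (hθ1 : θ < 1) {n : ℕ}
    (hn : 2 < θ * (2 * n - 1)) {A₁ A₂ E : ℝ} (hA₁ : 0 ≤ A₁) (hA₂ : 0 ≤ A₂) (hE : 0 < E) (C : ℝ) :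
    ∀ᶠ M : ℕ in atTop, 1 ≤ Real.log M ∧ 8 * Real.log M ^ θ ≤ M ∧
      A₁ * Real.log M ^ θ + A₂ * (Real.log M ^ θ / (Real.log M ^ θ) ^ (2 * n)) * (1 + Real.log M) ^ 3
        ≤ E * Real.log (M / Real.log M ^ θ) - C := by
  have hlog : Tendsto (fun M : ℕ ↦ Real.log M) atTop atTop :=
    Real.tendsto_log_atTop.comp tendsto_natCast_atTop_atTop
  have hb := hlog.eventually (eventually_budget hθ0 hθ1 hn hA₁ hA₂ hE C)
  have h1 := hlog.eventually (eventually_ge_atTop (1 : ℝ))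
  have h256 := eventually_ge_atTop (256 : ℕ)
  filter_upwards [hb, h1, h256] with M hbM h1M h256M
  have hMR : (256 : ℝ) ≤ M := by exact_mod_cast h256M
  have hM0 : (0 : ℝ) < M := by linarith
  set x : ℝ := Real.log M with hx
  have hx0 : 0 < x := by linarith
  have hκx : x ^ θ ≤ x := by
    calc x ^ θ ≤ x ^ (1 : ℝ) := Real.rpow_le_rpow_of_exponent_le h1M hθ1.le
      _ = x := Real.rpow_one x
  have hκ0 : 0 < x ^ θ := Real.rpow_pos_of_pos hx0 θ
  refine ⟨h1M, ?_, ?_⟩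
  · have := eight_mul_log_le hMR
    rw [← hx] at this
    nlinarith
  · -- `x/2 ≤ log(M/κ) = x - θ log x`
    have hlogq : x / 2 ≤ Real.log (M / x ^ θ) := by
      rw [Real.log_div hM0.ne' hκ0.ne', Real.log_rpow hx0, ← hx]
      have hlx : Real.log x ≤ x / 2 := Literature.NumberTheory.LFunctions.Real.log_le_half hx0
      have hlx0 : 0 ≤ Real.log x := Real.log_nonneg h1M
      nlinarith
    have : E * (x / 2) - C ≤ E * Real.log (M / x ^ θ) - C := by
      have := mul_le_mul_of_nonneg_left hlogq hE.le; linarith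
    exact hbM.trans this

/-! ## The stub -/

/-- **Stub `stub_combZeroSide` (registered signature): `ζ`-mollified resonator combs are
Weil-neutral.**  For a finitely supported real resonator `α` (`α_m = 0` for `m > L`), a Weil test
`b₁` supported in `[-1, 1]`, `0 < θ < 1` and `ε > 0` there is `M₀` such that for all `M ≥ M₀`,
with `κ = (log M)^θ` and `g(u) = ∑_{m ≤ LM} (∑_{k ∣ m, k ≤ M} α(m/k)/√k) b₁((u - log m) M/κ)`,
`|Re (W_polar(g ⋆ g̃) + W_arch(g ⋆ g̃) - ∑ₙ Λ(n) n^{-1/2} ((g ⋆ g̃)(log n) + (g ⋆ g̃)(-log n)))|`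
`≤ ε ∫ ‖g‖²`. [folklore] -/
theorem stub_combZeroSide :
    ∀ α : ℕ → ℝ, ∀ L : ℕ, (∀ m, L < m → α m = 0) →
      ∀ b₁ : ℝ → ℂ, IsWeilTest b₁ → tsupport b₁ ⊆ Set.Icc (-1) 1 →
      ∀ θ : ℝ, 0 < θ → θ < 1 → ∀ ε : ℝ, 0 < ε → ∃ M₀ : ℕ, ∀ M : ℕ, M₀ ≤ M →
        let κ : ℝ := Real.log M ^ θ
        let g : ℝ → ℂ := fun u => ∑ m ∈ Finset.range (L * M + 1),
          ((∑ k ∈ (Nat.divisors m).filter (· ≤ M), α (m / k) / Real.sqrt k : ℝ) : ℂ) *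
            b₁ ((u - Real.log m) * (M : ℝ) / κ)
        |(weilPolarTerm (weilConv g (weilReflect g)) + weilArchTerm (weilConv g (weilReflect g)) -
            ∑' n : ℕ, ((ArithmeticFunction.vonMangoldt n : ℝ) : ℂ) / (Real.sqrt n : ℂ) *
              (weilConv g (weilReflect g) (Real.log n) + weilConv g (weilReflect g) (-Real.log n))).re| ≤
          ε * ∫ u, ‖g u‖ ^ 2 := by
  intro α L hα b₁ hb hsupp θ hθ0 hθ1 ε hε
  -- the comb written with the scale `M/κ` (the form of the Literature lemmas)
  have hform : ∀ (M : ℕ) (κ : ℝ),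
      (fun u : ℝ ↦ ∑ m ∈ Finset.range (L * M + 1),
        ((∑ k ∈ (Nat.divisors m).filter (· ≤ M), α (m / k) / Real.sqrt k : ℝ) : ℂ) *
          b₁ ((u - Real.log m) * (M : ℝ) / κ))
      = fun u : ℝ ↦ ∑ m ∈ Finset.range (L * M + 1),
        ((∑ k ∈ (Nat.divisors m).filter (· ≤ M), α (m / k) / Real.sqrt k : ℝ) : ℂ) *
          b₁ ((u - Real.log m) * ((M : ℝ) / κ)) := by
    intro M κ; funext u; simp only [mul_div_assoc]
  by_cases hdeg : (∃ ℓ, 1 ≤ ℓ ∧ ℓ ≤ L ∧ α ℓ ≠ 0) ∧ (∫ u, ‖b₁ u‖ ^ 2) ≠ 0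
  · -- the non-degenerate case
    obtain ⟨hne, hB0⟩ := hdeg
    have hBpos : 0 < ∫ u, ‖b₁ u‖ ^ 2 :=
      lt_of_le_of_ne (integral_nonneg fun u ↦ by positivity) (Ne.symm hB0)
    set B : ℝ := ∫ u, ‖b₁ u‖ ^ 2 with hB
    -- the order of decay used above height `M/κ`
    set n : ℕ := ⌈1 / θ⌉₊ + 3 with hndef
    have hn3 : 3 ≤ n := by rw [hndef]; omega
    have hnθ : 2 < θ * (2 * n - 1) := by
      have h1 : (1 : ℝ) / θ ≤ ⌈1 / θ⌉₊ := Nat.le_ceil _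
      have h2 : (n : ℝ) = ⌈1 / θ⌉₊ + 3 := by rw [hndef]; push_cast; ring
      have h3 : 1 / θ * θ = 1 := div_mul_cancel₀ _ hθ0.ne'
      nlinarith
    -- constants
    obtain ⟨CZ, hCZ, hzero⟩ := exists_norm_weilZeroSidePartial_comb_le
    obtain ⟨cN, hcN, CN, hCN, hnorm⟩ := exists_integral_norm_sq_comb_ge hα hne hb hsupp
    set Cα : ℝ := ∑ ℓ ∈ Finset.Icc 1 L, |α ℓ| * Real.sqrt ℓ with hCα
    set W₁ : ℝ := weilL1 b₁ with hW₁
    set Dn : ℝ := weilL1 (deriv^[n] b₁) with hDn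
    set A₁ : ℝ := CZ * Cα ^ 2 * W₁ ^ 2 with hA₁
    set A₂ : ℝ := CZ * Cα ^ 2 * Dn ^ 2 with hA₂
    have hA₁0 : 0 ≤ A₁ := by positivity
    have hA₂0 : 0 ≤ A₂ := by positivity
    have hE : 0 < ε * B * cN := by positivity
    obtain ⟨M₀, hM₀⟩ := Filter.eventually_atTop.1
      (eventually_budget_nat hθ0 hθ1 hnθ hA₁0 hA₂0 hE (ε * B * CN))
    refine ⟨M₀, fun M hM ↦ ?_⟩
    obtain ⟨hlog1, h8κ, hbudget⟩ := hM₀ M hM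
    dsimp only
    simp only [mul_div_assoc]
    set κ : ℝ := Real.log M ^ θ with hκ
    have hκ1 : 1 ≤ κ := by
      rw [hκ]; exact Real.one_le_rpow hlog1 hθ0.le
    have hκ0 : 0 < κ := by linarith
    have hκM : κ ≤ M := by linarith
    have hM0 : (0 : ℝ) < M := by linarith
    set g : ℝ → ℂ := fun u : ℝ ↦ ∑ m ∈ Finset.range (L * M + 1),
      ((∑ k ∈ (Nat.divisors m).filter (· ≤ M), α (m / k) / Real.sqrt k : ℝ) : ℂ) *
        b₁ ((u - Real.log m) * ((M : ℝ) / κ)) with hg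
    set K : ℝ → ℂ := weilConv g (weilReflect g) with hK
    -- `g` and `K` are Weil tests
    have hgt : IsWeilTest g := isWeilTest_logComb hb _ _ (div_pos hM0 hκ0).ne'
    have hKt : IsWeilTest K := hgt.weilConv hgt.weilReflect
    -- the zero side
    have hZ : ∀ T : ℝ, ‖weilZeroSidePartial K T‖ ≤ CZ * Cα ^ 2 * (κ / M) ^ 2 *
        (W₁ ^ 2 * M + Dn ^ 2 / κ ^ (2 * n) * (1 + Real.log M) ^ 3 * M) :=
      fun T ↦ hzero α L hα b₁ hb n hn3 M κ hκ1 hκM T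
    have hW := norm_weilFunctional_le_of_partial_le hKt hZ
    -- the norm
    have hN := hnorm M κ hκ1 h8κ
    -- the budget: `ZERO ≤ ε · NORM`
    have halg : CZ * Cα ^ 2 * (κ / M) ^ 2 * (W₁ ^ 2 * M + Dn ^ 2 / κ ^ (2 * n) * (1 + Real.log M) ^ 3 * M)
        = κ / M * (A₁ * κ + A₂ * (κ / κ ^ (2 * n)) * (1 + Real.log M) ^ 3) := by
      rw [hA₁, hA₂]
      field_simp
    have hmain : CZ * Cα ^ 2 * (κ / M) ^ 2 * (W₁ ^ 2 * M + Dn ^ 2 / κ ^ (2 * n) * (1 + Real.log M) ^ 3 * M)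
        ≤ ε * ∫ u, ‖g u‖ ^ 2 := by
      rw [halg]
      calc κ / M * (A₁ * κ + A₂ * (κ / κ ^ (2 * n)) * (1 + Real.log M) ^ 3)
          ≤ κ / M * (ε * B * cN * Real.log (M / κ) - ε * B * CN) :=
            mul_le_mul_of_nonneg_left hbudget (by positivity)
        _ = ε * (κ / M * B * (cN * Real.log (M / κ) - CN)) := by ring
        _ ≤ ε * ∫ u, ‖g u‖ ^ 2 := mul_le_mul_of_nonneg_left hN hε.le
    -- conclusion
    have hfin : |(weilFunctional K).re| ≤ ε * ∫ u, ‖g u‖ ^ 2 :=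
      (Complex.abs_re_le_norm _).trans (hW.trans hmain)
    show |(weilPolarTerm K + weilArchTerm K -
        ∑' n : ℕ, ((ArithmeticFunction.vonMangoldt n : ℝ) : ℂ) / (Real.sqrt n : ℂ) *
          (K (Real.log n) + K (-Real.log n))).re| ≤ ε * ∫ u, ‖g u‖ ^ 2
    rw [polar_add_arch_sub_prime_eq K]
    exact hfin
  · -- the degenerate case: `g ≡ 0`
    refine ⟨1, fun M _ ↦ ?_⟩
    dsimp only
    simp only [mul_div_assoc]
    set κ : ℝ := Real.log M ^ θ with hκ
    have hcoef0 : (∀ m, (∑ k ∈ (Nat.divisors m).filter (· ≤ M), α (m / k) / Real.sqrt k : ℝ) = 0)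
        ∨ b₁ = 0 := by
      rw [not_and_or] at hdeg
      rcases hdeg with h | h
      · left
        intro m
        refine Finset.sum_eq_zero fun k hk ↦ ?_
        obtain ⟨hkd, -⟩ := Finset.mem_filter.1 hk
        obtain ⟨hkm, hm0⟩ := Nat.mem_divisors.1 hkd
        have hq1 : 1 ≤ m / k := by
          have hkpos : 0 < k := Nat.pos_of_dvd_of_pos hkm (Nat.pos_of_ne_zero hm0)
          exact Nat.div_pos (Nat.le_of_dvd (Nat.pos_of_ne_zero hm0) hkm) hkpos
        by_cases hqL : m / k ≤ L
        · have : α (m / k) = 0 := by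
            by_contra hne'
            exact h ⟨m / k, hq1, hqL, hne'⟩
          rw [this, zero_div]
        · rw [hα _ (not_le.1 hqL), zero_div]
      · right
        push Not at h
        exact hb.eq_zero_of_integral_norm_sq_eq_zero h
    have hterm : ∀ (m : ℕ) (y : ℝ),
        ((∑ k ∈ (Nat.divisors m).filter (· ≤ M), α (m / k) / Real.sqrt k : ℝ) : ℂ) * b₁ y = 0 := by
      intro m y
      rcases hcoef0 with h | h
      · rw [h m]; simp
      · rw [h]; simp
    have hg0 : (fun u : ℝ ↦ ∑ m ∈ Finset.range (L * M + 1),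
        ((∑ k ∈ (Nat.divisors m).filter (· ≤ M), α (m / k) / Real.sqrt k : ℝ) : ℂ) *
          b₁ ((u - Real.log m) * ((M : ℝ) / κ))) = 0 := by
      funext u
      simp only [Pi.zero_apply]
      exact Finset.sum_eq_zero fun m _ ↦ hterm m _
    rw [hg0]
    have hK0 : weilConv (0 : ℝ → ℂ) (weilReflect 0) = 0 := by
      unfold weilConv; exact zero_convolution
    rw [hK0]
    have hrhs : 0 ≤ ε * ∫ u, ‖∑ m ∈ Finset.range (L * M + 1),
        ((∑ k ∈ (Nat.divisors m).filter (· ≤ M), α (m / k) / Real.sqrt k : ℝ) : ℂ) *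
          b₁ ((u - Real.log m) * ((M : ℝ) / κ))‖ ^ 2 :=
      mul_nonneg hε.le (integral_nonneg fun u ↦ by positivity)
    have hlhs : weilPolarTerm (0 : ℝ → ℂ) + weilArchTerm 0 -
        ∑' n : ℕ, ((ArithmeticFunction.vonMangoldt n : ℝ) : ℂ) / (Real.sqrt n : ℂ) *
          ((0 : ℝ → ℂ) (Real.log n) + (0 : ℝ → ℂ) (-Real.log n)) = 0 := by
      simp [weilPolarTerm, weilArchTerm, weilArchIntegral, weilMellin]
    rw [hlhs]
    simpa using hrhs

end Summit.RiemannHypothesis.RiemannHypothesis.Theorems.SignConeConeMagnification
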